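import Literature.Computability.Complexity.Hastad3SatGame
import HarnessLib

/-!
# Smooth projection games by block revelation (Khot's smoothing of a repeated game)

A projection game `H : ProjGame E V U β α` (`ProjectionGames.lean`; in the application a parallel
repetition `B^{⊗T'}`) is turned into a game `H.block L hL v₀ b₀` whose projections are SMOOTH in the
sense of `Hastad3Sat.Smooth` / `ProjGame.SmoothAt`, the hypothesis of the soundness theorem of Håstad's
3-query test (`Hastad3SatGame.lean`, in place of Håstad's Lemma 6.9): Bob is asked `L` independent
questions of `H` at once (a vertex `w : Fin L → V`, a label `y : Fin L → β`); Alice is told a block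
`ℓ`, Bob's questions in all OTHER blocks, and an `H`-question of Alice for block `ℓ`; she must repeat
Bob's labels on the other blocks exactly and answer block `ℓ` consistently (the projection of the edge
`(ℓ, vs, e)` sends `y` to `(y` with block `ℓ` blanked`, π_e (y ℓ))`).  This is the device of Khot
(FOCS 2002, §3: the verifier reveals to the second prover the first prover's questions on most
coordinates) in block form, which keeps the residual game literally equal to `H`.  PROVED:

* `block_valLe` — **soundness is inherited**: `val(H) ≤ θ ⇒ val(H.block …) ≤ θ` (fix the block and
  the other questions: the residual game is `H`);
* `block_sat` — **completeness is inherited**: perfect strategies of `H` give perfect strategies;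
* `block_smoothAt` — **smoothness**: if `H` is regular on Bob's side (`wV ≡ ω`), the block game is
  `(T, T²/L)`-smooth for every `T`: two distinct admissible labels `y ≠ y'` of `w` are identified by
  the projection of an edge in block `ℓ` only if they differ exactly in block `ℓ`, so a set of `≤ T`
  labels spoils at most `T²` of the `L` equiprobable blocks;
* `adm_block_iff` — the admissible labels of `w` are the tuples of admissible labels of `H`.

## References

* S. Khot, *Hardness results for coloring 3-colorable 3-uniform hypergraphs*, FOCS 2002, §3 (smooth
  label cover from parallel repetition by revealing coordinates) [Khot2002].
* J. Håstad, *Some optimal inapproximability results*, J. ACM 48 (2001), §6.1 (the role of Lemma 6.9)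
  [Hastad2001].
-/

noncomputable section

namespace Literature.Computability.Complexity

namespace ProjGame

open Finset Literature.Computability.Complexity.Hastad3Sat

variable {E V U β α : Type}

/-- Alice's vertices of the block game: a block `ℓ`, Bob's questions with block `ℓ` blanked to `v₀`,
and an `H`-question for block `ℓ`. [cite: Khot2002, §3 (smooth label cover: the questions of the second prover)] -/
abbrev BlockU (V U : Type) (L : ℕ) (v₀ : V) : Type :=
  {p : Fin L × (Fin L → V) × U // p.2.1 p.1 = v₀}

/-- **The block game** `H.block L hL v₀ b₀` (`L ≥ 1` blocks; `v₀`, `b₀` are the blanks).  Edges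
`(ℓ, vs, e)`: block `ℓ`, the other questions `vs` (its block `ℓ` is overwritten), an edge `e` of `H`;
Bob's vertex `vs[ℓ ↦ src e]`, Alice's vertex `(ℓ, vs[ℓ ↦ v₀], dst e)`, weight `w_e`, and the
projection `y ↦ (y[ℓ ↦ b₀], π_e (y ℓ))`. [cite: Khot2002, §3 (smooth label cover by revealing coordinates of a repeated game)] -/
def block (H : ProjGame E V U β α) (L : ℕ) (hL : 0 < L) (v₀ : V) (b₀ : β) :
    ProjGame (Fin L × (Fin L → V) × E) (Fin L → V) (BlockU V U L v₀) (Fin L → β)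
      ((Fin L → β) × α) where
  src e := Function.update e.2.1 e.1 (H.src e.2.2)
  dst e := ⟨(e.1, Function.update e.2.1 e.1 v₀, H.dst e.2.2), by simp⟩
  proj e y := (H.proj e.2.2 (y e.1)).map fun a => (Function.update y e.1 b₀, a)
  wt e := H.wt e.2.2
  wt_pos e := H.wt_pos e.2.2
  src_surj w := by
    obtain ⟨e, he⟩ := H.src_surj (w ⟨0, hL⟩)
    exact ⟨(⟨0, hL⟩, w, e), by simp [he]⟩
  dst_surj := by
    rintro ⟨⟨ℓ, vs, u⟩, h⟩
    obtain ⟨e, he⟩ := H.dst_surj u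
    refine ⟨(ℓ, vs, e), Subtype.ext ?_⟩
    simp only [he, Prod.mk.injEq, true_and, and_true]
    simpa using h.symm

variable (H : ProjGame E V U β α) (L : ℕ) (hL : 0 < L) (v₀ : V) (b₀ : β)

/-- `src` of the block game (definitional). [folklore] -/
@[simp] theorem block_src (e : Fin L × (Fin L → V) × E) :
    (H.block L hL v₀ b₀).src e = Function.update e.2.1 e.1 (H.src e.2.2) := rfl

/-- `dst` of the block game (definitional). [folklore] -/
@[simp] theorem block_dst_val (e : Fin L × (Fin L → V) × E) :
    ((H.block L hL v₀ b₀).dst e).1 = (e.1, Function.update e.2.1 e.1 v₀, H.dst e.2.2) := rfl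

/-- `proj` of the block game (definitional). [folklore] -/
@[simp] theorem block_proj (e : Fin L × (Fin L → V) × E) (y : Fin L → β) :
    (H.block L hL v₀ b₀).proj e y = (H.proj e.2.2 (y e.1)).map fun a => (Function.update y e.1 b₀, a) :=
  rfl

/-- `wt` of the block game (definitional). [folklore] -/
@[simp] theorem block_wt (e : Fin L × (Fin L → V) × E) : (H.block L hL v₀ b₀).wt e = H.wt e.2.2 := rfl

/-! ### Completeness -/

/-- **Completeness is inherited**: perfect strategies `b, a` of `H` give perfect strategies of the
block game — Bob answers blockwise, Alice copies Bob's would-be labels on the other blocks.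
[cite: Hastad2001, Lemma 6.12] -/
theorem block_sat {b : V → β} {a : U → α} (hsat : ∀ e, H.proj e (b (H.src e)) = some (a (H.dst e))) :
    ∀ e, (H.block L hL v₀ b₀).proj e ((fun w : Fin L → V => fun ℓ => b (w ℓ)) ((H.block L hL v₀ b₀).src e)) =
      some ((fun p : BlockU V U L v₀ => (Function.update (fun ℓ => b (p.1.2.1 ℓ)) p.1.1 b₀, a p.1.2.2))
        ((H.block L hL v₀ b₀).dst e)) := by
  rintro ⟨ℓ, vs, e⟩
  simp only [block_proj, block_src, block_dst_val, Function.update_self, hsat e, Option.map_some,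
    Option.some.injEq, Prod.mk.injEq, and_true]
  funext m
  by_cases hm : m = ℓ
  · subst hm; simp
  · simp [Function.update_of_ne hm]

/-! ### Soundness: the value is inherited -/

/-- Sums over the edges of the block game, block and other questions first. [folklore] -/
theorem sum_blockEdge [Fintype E] [Fintype V] (F : Fin L × (Fin L → V) × E → ℝ) :
    ∑ e, F e = ∑ ℓ : Fin L, ∑ vs : Fin L → V, ∑ e : E, F (ℓ, vs, e) := by
  rw [Fintype.sum_prod_type]
  exact sum_congr rfl fun ℓ _ => Fintype.sum_prod_type _

/-- The total weight of the block game: `L · |V|^L · total(H)`. [folklore] -/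
theorem block_total [Fintype E] [Fintype V] :
    (H.block L hL v₀ b₀).total = L * (Fintype.card V) ^ L * H.total := by
  unfold total
  rw [sum_blockEdge]
  simp only [block_wt, sum_const, card_univ, Fintype.card_fun, Fintype.card_fin, nsmul_eq_mul]
  push_cast
  ring

/-- **Soundness is inherited**: `val(H) ≤ θ` implies `val(H.block …) ≤ θ` — for a fixed block
`ℓ` and fixed other questions `vs`, the strategies of the block game restrict to strategies of `H`, and
an edge of the block game is satisfied only if the corresponding edge of `H` is.
[cite: Hastad2001, §6.1 (soundness of the two-prover protocol, Thm 6.5 via Lemma 6.13)] -/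
theorem block_valLe [Fintype E] [Fintype V] [DecidableEq α] [DecidableEq β] {θ : ℝ}
    (hval : H.ValLe θ) : (H.block L hL v₀ b₀).ValLe θ := by
  intro b a
  unfold satW
  rw [sum_blockEdge, block_total]
  -- for fixed `ℓ, vs` compare with `H`
  have hfix : ∀ (ℓ : Fin L) (vs : Fin L → V),
      ∑ e : E, (if (H.block L hL v₀ b₀).proj (ℓ, vs, e) (b ((H.block L hL v₀ b₀).src (ℓ, vs, e))) =
          some (a ((H.block L hL v₀ b₀).dst (ℓ, vs, e))) then (H.block L hL v₀ b₀).wt (ℓ, vs, e) else 0) ≤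
        θ * H.total := by
    intro ℓ vs
    set b' : V → β := fun v => b (Function.update vs ℓ v) ℓ with hb'
    set a' : U → α := fun u => (a ⟨(ℓ, Function.update vs ℓ v₀, u), by simp⟩).2 with ha'
    refine le_trans (sum_le_sum fun e _ => ?_) (hval b' a')
    simp only [block_proj, block_src, block_wt]
    by_cases hH : H.proj e (b' (H.src e)) = some (a' (H.dst e))
    · rw [if_pos hH]
      split_ifs
      · exact le_rfl
      · exact H.wt_nonneg e
    · rw [if_neg hH, if_neg]
      · intro h
        apply hH
        simp only [hb', ha']
        cases hpe : H.proj e (b (Function.update vs ℓ (H.src e)) ℓ) with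
        | none => rw [hpe] at h; simp at h
        | some x =>
          rw [hpe] at h
          simp only [Option.map_some, Option.some.injEq] at h
          have h2 := congrArg Prod.snd h
          simp only at h2
          rw [h2]
          rfl
  calc ∑ ℓ : Fin L, ∑ vs : Fin L → V, ∑ e : E,
        (if (H.block L hL v₀ b₀).proj (ℓ, vs, e) (b ((H.block L hL v₀ b₀).src (ℓ, vs, e))) =
            some (a ((H.block L hL v₀ b₀).dst (ℓ, vs, e))) then (H.block L hL v₀ b₀).wt (ℓ, vs, e) else 0)
      ≤ ∑ ℓ : Fin L, ∑ vs : Fin L → V, θ * H.total :=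
        sum_le_sum fun ℓ _ => sum_le_sum fun vs _ => hfix ℓ vs
    _ = θ * (L * (Fintype.card V) ^ L * H.total) := by
        simp only [sum_const, card_univ, Fintype.card_fun, Fintype.card_fin, nsmul_eq_mul]
        push_cast
        ring

/-! ### Admissible labels and projections of the block game -/

/-- The admissible labels of `w` in the block game are the tuples of admissible labels of `H`.
[cite: Hastad2001, §2.6 (conditioning)] -/
theorem adm_block_iff (w : Fin L → V) (y : Fin L → β) :
    (H.block L hL v₀ b₀).Adm w y ↔ ∀ ℓ, H.Adm (w ℓ) (y ℓ) := by
  constructor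
  · intro h ℓ e he
    have := h (ℓ, w, e) (by simp [he])
    simpa using this
  · rintro h ⟨ℓ, vs, e⟩ he
    simp only [block_src] at he
    have hsrc : H.src e = w ℓ := by
      have := congrFun he ℓ
      simpa using this
    have := h ℓ e hsrc
    simp only [block_proj, Option.isSome_map]
    exact this

/-- The first component of a total projection of the block game blanks the block.
[cite: Hastad2001, §6.1] -/
theorem tproj_block_fst (w : Fin L → V) (j : (H.block L hL v₀ b₀).EdgeAt w) (y : (H.block L hL v₀ b₀).Lab w) :
    ((H.block L hL v₀ b₀).tproj w j y).1 = Function.update y.1 j.1.1 b₀ := by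
  have h := (H.block L hL v₀ b₀).proj_eq_some_tproj w j y
  simp only [block_proj] at h
  cases hpe : H.proj j.1.2.2 (y.1 j.1.1) with
  | none => rw [hpe] at h; simp at h
  | some x =>
    rw [hpe] at h
    simp only [Option.map_some, Option.some.injEq] at h
    rw [← h]

/-! ### Smoothness -/

/-- Two tuples blanked at `ℓ` agree iff they agree off `ℓ`. [folklore] -/
theorem update_eq_update_iff {L' : ℕ} {X : Type} (y y' : Fin L' → X) (ℓ : Fin L') (x : X) :
    Function.update y ℓ x = Function.update y' ℓ x ↔ ∀ m, m ≠ ℓ → y m = y' m := by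
  rw [Function.update_eq_iff]
  constructor
  · rintro ⟨-, h⟩ m hm
    rw [h m hm, Function.update_of_ne hm]
  · intro h
    exact ⟨by simp, fun m hm => by rw [Function.update_of_ne hm, h m hm]⟩

/-- Distinct tuples are identified by blanking at most one block. [folklore] -/
theorem blank_unique {L' : ℕ} {X : Type} {y y' : Fin L' → X} (hne : y ≠ y') {ℓ ℓ' : Fin L'} (x : X)
    (h : Function.update y ℓ x = Function.update y' ℓ x)
    (h' : Function.update y ℓ' x = Function.update y' ℓ' x) : ℓ = ℓ' := by
  by_contra hll
  rw [update_eq_update_iff] at h h'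
  apply hne
  funext m
  by_cases hm : m = ℓ
  · exact h' m (hm ▸ hll)
  · exact h m hm

/-- The other questions of an edge at `w` in block `ℓ` range over `|V|` tuples: those agreeing with `w`
off `ℓ`. [folklore] -/
theorem card_filter_agree_off [Fintype V] [DecidableEq V] (w : Fin L → V) (ℓ : Fin L) :
    (univ.filter fun vs : Fin L → V => ∀ m, m ≠ ℓ → vs m = w m).card = Fintype.card V := by
  have h : (univ.filter fun vs : Fin L → V => ∀ m, m ≠ ℓ → vs m = w m) =
      univ.image fun x : V => Function.update w ℓ x := by
    ext vs
    simp only [mem_filter, mem_univ, true_and, mem_image]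
    constructor
    · intro hvs
      refine ⟨vs ℓ, ?_⟩
      funext m
      by_cases hm : m = ℓ
      · subst hm; simp
      · rw [Function.update_of_ne hm, hvs m hm]
    · rintro ⟨x, rfl⟩ m hm
      rw [Function.update_of_ne hm]
  rw [h, card_image_of_injective _ fun x x' hxx' => by
    have := congrFun hxx' ℓ; simpa using this]
  exact card_univ

/-- The weight of the edges at `w` lying in block `ℓ`: `|V| · wV_H(w ℓ)`. [folklore] -/
theorem sum_block_at [Fintype E] [Fintype V] [DecidableEq V] (w : Fin L → V) (ℓ : Fin L) :
    ∑ vs : Fin L → V, ∑ e : E, (if Function.update vs ℓ (H.src e) = w then H.wt e else 0) =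
      Fintype.card V * H.wV (w ℓ) := by
  have h1 : ∀ vs : Fin L → V, ∑ e : E, (if Function.update vs ℓ (H.src e) = w then H.wt e else 0) =
      if (∀ m, m ≠ ℓ → vs m = w m) then H.wV (w ℓ) else 0 := by
    intro vs
    by_cases hvs : ∀ m, m ≠ ℓ → vs m = w m
    · rw [if_pos hvs]
      unfold wV
      refine sum_congr rfl fun e _ => ?_
      congr 1
      rw [Function.update_eq_iff]
      simp only [eq_iff_iff]
      exact ⟨fun h => h.1, fun h => ⟨h, fun m hm => hvs m hm⟩⟩
    · rw [if_neg hvs]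
      refine sum_eq_zero fun e _ => ?_
      rw [if_neg]
      rw [Function.update_eq_iff]
      exact fun h => hvs h.2
  simp_rw [h1]
  rw [← sum_filter, sum_const, card_filter_agree_off, nsmul_eq_mul]

/-- **Bob's weights in the block game**: `wV(w) = |V| · ∑_ℓ wV_H(w ℓ)`. [folklore] -/
theorem block_wV [Fintype E] [Fintype V] [DecidableEq V] (w : Fin L → V) :
    (H.block L hL v₀ b₀).wV w = Fintype.card V * ∑ ℓ : Fin L, H.wV (w ℓ) := by
  unfold wV
  rw [sum_blockEdge]
  simp only [block_src, block_wt]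
  rw [mul_sum]
  exact sum_congr rfl fun ℓ _ => H.sum_block_at L w ℓ

/-- **Smoothness of the block game** (the substitute for Håstad's Lemma 6.9 / Cor. 6.10): if `H` is
regular on Bob's side, `wV_H ≡ ω`, then `H.block L …` is `(T, T²/L)`-smooth for every `T` — a set `β'`
of at most `T` admissible labels of `w` is mapped injectively by the projection of every edge at `w`
whose block is not one of the at most `T²` blocks at which two members of `β'` differ exactly.
[cite: Khot2002, §3 (smoothness property of the label cover)] -/
theorem block_smoothAt [Fintype E] [Fintype V] [DecidableEq E] [DecidableEq V] [DecidableEq β]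
    {ω : ℝ} (hreg : ∀ v, H.wV v = ω) (T : ℕ) :
    (H.block L hL v₀ b₀).SmoothAt T ((T : ℝ) ^ 2 / L) := by
  classical
  set M := H.block L hL v₀ b₀ with hM
  intro w β' hβ'
  have hω : 0 < ω := by rw [← hreg (w ⟨0, hL⟩)]; exact H.wV_pos _
  have hLpos : (0 : ℝ) < L := by exact_mod_cast hL
  have hVpos : (0 : ℝ) < Fintype.card V := by
    have : Nonempty V := ⟨v₀⟩
    exact_mod_cast Fintype.card_pos
  -- the blocks at which two members of `β'` differ exactly
  set Bad : Finset (Fin L) := univ.filter fun ℓ => ∃ y ∈ β', ∃ y' ∈ β', y ≠ y' ∧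
    Function.update y.1 ℓ b₀ = Function.update y'.1 ℓ b₀ with hBad
  -- `|Bad| ≤ T²`: every pair of distinct labels is blanked together in at most one block
  have hBadcard : (Bad.card : ℝ) ≤ (T : ℝ) ^ 2 := by
    have hsub : Bad ⊆ (β' ×ˢ β').biUnion fun p => univ.filter fun ℓ =>
        p.1 ≠ p.2 ∧ Function.update p.1.1 ℓ b₀ = Function.update p.2.1 ℓ b₀ := by
      intro ℓ hℓ
      rw [hBad, mem_filter] at hℓ
      obtain ⟨-, y, hy, y', hy', hne, heq⟩ := hℓ
      rw [mem_biUnion]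
      exact ⟨(y, y'), mem_product.2 ⟨hy, hy'⟩, mem_filter.2 ⟨mem_univ _, hne, heq⟩⟩
    have hone : ∀ p ∈ β' ×ˢ β', (univ.filter fun ℓ : Fin L =>
        p.1 ≠ p.2 ∧ Function.update p.1.1 ℓ b₀ = Function.update p.2.1 ℓ b₀).card ≤ 1 := by
      intro p _
      rw [card_le_one]
      intro ℓ hℓ ℓ' hℓ'
      rw [mem_filter] at hℓ hℓ'
      exact blank_unique (fun h => hℓ.2.1 (Subtype.ext h)) b₀ hℓ.2.2 hℓ'.2.2
    have h1 : Bad.card ≤ (β' ×ˢ β').card * 1 :=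
      (card_le_card hsub).trans (card_biUnion_le_card_mul _ _ 1 hone)
    rw [mul_one, card_product] at h1
    calc (Bad.card : ℝ) ≤ (β'.card * β'.card : ℕ) := by exact_mod_cast h1
      _ ≤ (T : ℝ) ^ 2 := by
          push_cast
          rw [sq]
          exact mul_le_mul (by exact_mod_cast hβ') (by exact_mod_cast hβ') (Nat.cast_nonneg _)
            (Nat.cast_nonneg _)
  -- the good edges: those outside the bad blocks
  refine ⟨univ.filter fun j : M.EdgeAt w => j.1.1 ∉ Bad, fun j hj => ?_, ?_⟩
  · -- injectivity on a good edge
    rw [mem_filter] at hj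
    intro y hy y' hy' hyy'
    by_contra hne
    apply hj.2
    rw [hBad, mem_filter]
    refine ⟨mem_univ _, y, hy, y', hy', hne, ?_⟩
    have h1 := H.tproj_block_fst L hL v₀ b₀ w j y
    have h2 := H.tproj_block_fst L hL v₀ b₀ w j y'
    rw [← h1, ← h2]
    exact congrArg Prod.fst hyy'
  · -- the weight of the bad edges
    have hcompl : (univ.filter fun j : M.EdgeAt w => j.1.1 ∉ Bad)ᶜ = univ.filter fun j : M.EdgeAt w => j.1.1 ∈ Bad := by
      ext j; simp
    rw [hcompl, sum_filter]
    -- numerator and denominator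
    have hwV : M.wV w = Fintype.card V * (L * ω) := by
      rw [hM, block_wV]
      simp only [hreg, sum_const, card_univ, Fintype.card_fin, nsmul_eq_mul]
    have hnum : ∑ j : M.EdgeAt w, (if j.1.1 ∈ Bad then M.wt j.1 else 0) = Bad.card * (Fintype.card V * ω) := by
      rw [M.sum_edgeAt w fun e' => if e'.1 ∈ Bad then M.wt e' else 0]
      rw [hM, sum_blockEdge]
      simp only [block_src, block_wt]
      have hℓ : ∀ ℓ : Fin L, ∑ vs : Fin L → V, ∑ e : E,
          (if Function.update vs ℓ (H.src e) = w then (if ℓ ∈ Bad then H.wt e else 0) else 0) =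
          if ℓ ∈ Bad then Fintype.card V * ω else 0 := by
        intro ℓ
        by_cases hb : ℓ ∈ Bad
        · simp only [hb, if_true]
          rw [H.sum_block_at L w ℓ, hreg]
        · simp only [hb, if_false, ite_self, sum_const_zero]
      simp_rw [hℓ]
      rw [← sum_filter, sum_const, nsmul_eq_mul]
      congr 1
      simp [hBad]
    have hwAt : ∀ j : M.EdgeAt w, (if j.1.1 ∈ Bad then M.wAt w j else 0) =
        (if j.1.1 ∈ Bad then M.wt j.1 else 0) / M.wV w := fun j => by
      unfold wAt; split_ifs <;> simp
    simp_rw [hwAt]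
    rw [← sum_div, hnum, hwV]
    rw [div_le_div_iff₀ (by positivity) hLpos]
    calc Bad.card * (Fintype.card V * ω) * L = (Bad.card : ℝ) * (Fintype.card V * (L * ω)) := by ring
      _ ≤ (T : ℝ) ^ 2 * (Fintype.card V * (L * ω)) :=
          mul_le_mul_of_nonneg_right hBadcard (by positivity)

end ProjGame

end Literature.Computability.Complexity

end
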